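import Literature.Analysis.FluidPDE.OseenHeatLpBounds
import Literature.Analysis.FluidPDE.OseenHeatSemigroup
import HarnessLib

/-!
# Linearity of the Oseen–heat operator `e^{τΔ} P ∇·` on `Lᵖ` matrix fields

Analysis/FluidPDE support file for Kato's `L³` theory of mild solutions (Kato 1984, Thm. 1;
Lemarié-Rieusset 2016, Thm. 7.5; programme discharging `kato_local_L3`, `MildL3Smooth.lean`, and
`kato_solution_le_div_sqrt`, `RusinSverakLeraySolutions.lean`). The tree's realisation
`(𝒩_τ F)ᵢ = ∑ⱼ ∂ⱼ e^{τΔ} Fⱼᵢ + ∑ⱼₖ ∫₀^∞ ∂ᵢ∂ⱼ∂ₖ e^{(τ+σ)Δ} Fⱼₖ dσ` (`oseenHeat`, `OseenHeat.lean`)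
is built from absolutely convergent integrals, so it is linear in `F` on every `Lᵖ`,
`1 ≤ p ≤ ∞` — the bilinearity `B(u,u) - B(v,v) = B(u - v, u) + B(v, u - v)` of the Navier–Stokes
Duhamel term used in every Picard/uniqueness argument (Lemarié-Rieusset 2016, (7.54); Kato 1984,
proof of Thm. 1). This file records:

* `heatD1_add_of_memLp`, `heatD1_smul`, `heatD1_sub_of_memLp` and the `heatD3` analogues
  (additivity of the convolution `∂ᵥG_a ⋆ f` where it converges, `ConvolutionExistsAt.distrib_add`);
* `integrable_heatD3_const_add_of_memLp` — the Leray-correction integrand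
  `σ ↦ ∂³ e^{(τ+σ)Δ} f (x)` is integrable on `(0, ∞)` for `f ∈ Lᵖ` (continuity in `σ`,
  `OseenHeatSemigroup.lean`, and the decay `C (τ+σ)^{-(3/2+3/(2p))} ‖f‖_p` of
  `OseenHeatLpBounds.lean`), dimension three;
* `oseenHeat_add_of_memLp`, `oseenHeat_smul_of_memLp`, `oseenHeat_sub_of_memLp`,
  `oseenHeat_neg_of_memLp` — linearity of `F ↦ (𝒩_τ F)ᵢ (x)` at every point, dimension three.

## Mathlib / tree search

Tree: `heatD1_eq_convolution`, `memLp_heatD1`, `heatD3_eq_heatD1_heatD1_heatD1`, `oseenHeat`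
(`OseenHeat.lean`); `continuousOn_heatD3_const_add`, `integrableOn_const_mul_rpow_const_add`
(`OseenHeatSemigroup.lean`); `exists_enorm_heatD3_le_rpow` (`OseenHeatLpBounds.lean`);
`UnboundedOperators.convolutionExistsAt_of_memLp`, `memLp_fderiv_heatKernel_apply`
(`HeatKernel.lean`, `HeatFlowCalculus.lean`). Mathlib: `ConvolutionExistsAt.distrib_add`,
`convolution_smul`, `integral_add`, `integral_smul`, `ContinuousOn.aestronglyMeasurable`.

## References

* T. Kato, Math. Z. 187 (1984) 471–480, proof of Thm. 1 (the bilinear form `G(u, v)`). [Kato1984]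
* P. G. Lemarié-Rieusset, *The Navier–Stokes Problem in the 21st Century*, CRC Press 2016,
  doi:10.1201/b19556, §6.2 and (7.54). [LemarieRieusset2016]
-/

noncomputable section

open MeasureTheory TopologicalSpace Set Function Filter Topology
open scoped ENNReal NNReal RealInnerProductSpace Convolution

namespace Literature.Analysis.FluidPDE

variable {E : Type*} [NormedAddCommGroup E] [InnerProductSpace ℝ E] [FiniteDimensional ℝ E]
  [MeasurableSpace E] [BorelSpace E]

/-! ### One layer -/

section D1

variable {p : ℝ≥0∞} {f g : E → ℝ}

/-- **Additivity of `∂ᵥ e^{aΔ}` on `Lᵖ`**: `∂ᵥe^{aΔ}(f + g) = ∂ᵥe^{aΔ}f + ∂ᵥe^{aΔ}g` for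
`f, g ∈ Lᵖ`, `1 ≤ p`, `a > 0` (the convolutions `∂ᵥG_a ⋆ f`, `∂ᵥG_a ⋆ g` converge at every point).
[folklore] -/
theorem heatD1_add_of_memLp (hf : MemLp f p volume) (hg : MemLp g p volume) (hp : 1 ≤ p)
    {a : ℝ} (ha : 0 < a) (v : E) :
    heatD1 a v (f + g) = heatD1 a v f + heatD1 a v g := by
  haveI : p.HolderConjugate (ENNReal.conjExponent p) := .conjExponent hp
  set K : E → ℝ := fun z => fderiv ℝ (UnboundedOperators.heatKernel (E := E) a) z v with hK
  have hKq : MemLp K (ENNReal.conjExponent p) volume :=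
    UnboundedOperators.memLp_fderiv_heatKernel_apply ha v _
  rw [heatD1_eq_convolution (hf.add hg) hp ha v, heatD1_eq_convolution hf hp ha v,
    heatD1_eq_convolution hg hp ha v]
  funext x
  exact ConvolutionExistsAt.distrib_add
    (UnboundedOperators.convolutionExistsAt_of_memLp (ContinuousLinearMap.lsmul ℝ ℝ) hKq hf x)
    (UnboundedOperators.convolutionExistsAt_of_memLp (ContinuousLinearMap.lsmul ℝ ℝ) hKq hg x)

/-- **Homogeneity of `∂ᵥ e^{aΔ}`**: `∂ᵥe^{aΔ}(c f) = c ∂ᵥe^{aΔ}f` for `f ∈ Lᵖ`. [folklore] -/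
theorem heatD1_smul_of_memLp (hf : MemLp f p volume) (hp : 1 ≤ p) {a : ℝ} (ha : 0 < a) (v : E)
    (c : ℝ) : heatD1 a v (c • f) = c • heatD1 a v f := by
  rw [heatD1_eq_convolution (hf.const_smul c) hp ha v, heatD1_eq_convolution hf hp ha v]
  exact convolution_smul

/-- `∂ᵥe^{aΔ}(-f) = -∂ᵥe^{aΔ}f` for `f ∈ Lᵖ`. [folklore] -/
theorem heatD1_neg_of_memLp (hf : MemLp f p volume) (hp : 1 ≤ p) {a : ℝ} (ha : 0 < a) (v : E) :
    heatD1 a v (-f) = -heatD1 a v f := by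
  have h := heatD1_smul_of_memLp hf hp ha v (-1)
  simp only [neg_one_smul] at h
  exact h

/-- `∂ᵥe^{aΔ}(f - g) = ∂ᵥe^{aΔ}f - ∂ᵥe^{aΔ}g` for `f, g ∈ Lᵖ`. [folklore] -/
theorem heatD1_sub_of_memLp (hf : MemLp f p volume) (hg : MemLp g p volume) (hp : 1 ≤ p)
    {a : ℝ} (ha : 0 < a) (v : E) :
    heatD1 a v (f - g) = heatD1 a v f - heatD1 a v g := by
  rw [sub_eq_add_neg, heatD1_add_of_memLp hf hg.neg hp ha v, heatD1_neg_of_memLp hg hp ha v,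
    ← sub_eq_add_neg]

end D1

/-! ### Three layers -/

section D3

variable {p : ℝ≥0∞} {f g : E → ℝ}

/-- **Additivity of `∂ᵤ∂ᵥ∂_w e^{sΔ}` on `Lᵖ`** (three additive layers at the clock `s/3`).
[folklore] -/
theorem heatD3_add_of_memLp (hf : MemLp f p volume) (hg : MemLp g p volume) (hp : 1 ≤ p)
    {s : ℝ} (hs : 0 < s) (u v w : E) :
    heatD3 s u v w (f + g) = heatD3 s u v w f + heatD3 s u v w g := by
  have h3 : 0 < s / 3 := by positivity
  have hs3 : s / 3 + s / 3 + s / 3 = s := by ring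
  have hD3 : ∀ φ : E → ℝ, MemLp φ p volume →
      heatD3 s u v w φ = heatD1 (s / 3) u (heatD1 (s / 3) v (heatD1 (s / 3) w φ)) := by
    intro φ hφ
    have := heatD3_eq_heatD1_heatD1_heatD1 hφ hp h3 h3 h3 u v w
    rwa [hs3] at this
  have hf₁ : MemLp (heatD1 (s / 3) w f) p volume := memLp_heatD1 hf hp h3 w
  have hg₁ : MemLp (heatD1 (s / 3) w g) p volume := memLp_heatD1 hg hp h3 w
  have hf₂ : MemLp (heatD1 (s / 3) v (heatD1 (s / 3) w f)) p volume := memLp_heatD1 hf₁ hp h3 v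
  have hg₂ : MemLp (heatD1 (s / 3) v (heatD1 (s / 3) w g)) p volume := memLp_heatD1 hg₁ hp h3 v
  rw [hD3 (f + g) (hf.add hg), hD3 f hf, hD3 g hg, heatD1_add_of_memLp hf hg hp h3 w,
    heatD1_add_of_memLp hf₁ hg₁ hp h3 v, heatD1_add_of_memLp hf₂ hg₂ hp h3 u]

/-- **Homogeneity of `∂ᵤ∂ᵥ∂_w e^{sΔ}` on `Lᵖ`**. [folklore] -/
theorem heatD3_smul_of_memLp (hf : MemLp f p volume) (hp : 1 ≤ p) {s : ℝ} (hs : 0 < s)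
    (u v w : E) (c : ℝ) : heatD3 s u v w (c • f) = c • heatD3 s u v w f := by
  have h3 : 0 < s / 3 := by positivity
  have hs3 : s / 3 + s / 3 + s / 3 = s := by ring
  have hD3 : ∀ φ : E → ℝ, MemLp φ p volume →
      heatD3 s u v w φ = heatD1 (s / 3) u (heatD1 (s / 3) v (heatD1 (s / 3) w φ)) := by
    intro φ hφ
    have := heatD3_eq_heatD1_heatD1_heatD1 hφ hp h3 h3 h3 u v w
    rwa [hs3] at this
  have hf₁ : MemLp (heatD1 (s / 3) w f) p volume := memLp_heatD1 hf hp h3 w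
  have hf₂ : MemLp (heatD1 (s / 3) v (heatD1 (s / 3) w f)) p volume := memLp_heatD1 hf₁ hp h3 v
  rw [hD3 (c • f) (hf.const_smul c), hD3 f hf, heatD1_smul_of_memLp hf hp h3 w,
    heatD1_smul_of_memLp hf₁ hp h3 v, heatD1_smul_of_memLp hf₂ hp h3 u]

/-- `∂³e^{sΔ}(-f) = -∂³e^{sΔ}f` on `Lᵖ`. [folklore] -/
theorem heatD3_neg_of_memLp (hf : MemLp f p volume) (hp : 1 ≤ p) {s : ℝ} (hs : 0 < s)
    (u v w : E) : heatD3 s u v w (-f) = -heatD3 s u v w f := by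
  have h := heatD3_smul_of_memLp hf hp hs u v w (-1)
  simp only [neg_one_smul] at h
  exact h

/-- `∂³e^{sΔ}(f - g) = ∂³e^{sΔ}f - ∂³e^{sΔ}g` on `Lᵖ`. [folklore] -/
theorem heatD3_sub_of_memLp (hf : MemLp f p volume) (hg : MemLp g p volume) (hp : 1 ≤ p)
    {s : ℝ} (hs : 0 < s) (u v w : E) :
    heatD3 s u v w (f - g) = heatD3 s u v w f - heatD3 s u v w g := by
  rw [sub_eq_add_neg, heatD3_add_of_memLp hf hg.neg hp hs u v w, heatD3_neg_of_memLp hg hp hs u v w,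
    ← sub_eq_add_neg]

variable (hE : Module.finrank ℝ E = 3)
include hE

/-- **Integrability of the Leray-correction integrand** `σ ↦ ∂ᵤ∂ᵥ∂_w e^{(τ+σ)Δ} f (x)` on
`(0, ∞)`, for `f ∈ Lᵖ`, `1 ≤ p ≤ ∞`, `τ > 0`, unit vectors `u, v, w`, dimension three: continuous in
`σ` and dominated by `C ‖f‖_p (τ+σ)^{-(3/2+3/(2p))}`. [folklore] -/
theorem integrable_heatD3_const_add_of_memLp (hp : 1 ≤ p) (hf : MemLp f p volume) {τ : ℝ}
    (hτ : 0 < τ) {u v w : E} (hu : ‖u‖ ≤ 1) (hv : ‖v‖ ≤ 1) (hw : ‖w‖ ≤ 1) (x : E) :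
    Integrable (fun σ : ℝ => heatD3 (τ + σ) u v w f x) (volume.restrict (Ioi (0 : ℝ))) := by
  obtain ⟨C, hC⟩ := exists_enorm_heatD3_le_rpow hE hp
  set e : ℝ := 3 / 2 + 3 / 2 * (1 / p).toReal with he
  have he1 : 1 < e := by
    rw [he]
    have : 0 ≤ (1 / p).toReal := ENNReal.toReal_nonneg
    linarith
  set A : ℝ := (C : ℝ) * (eLpNorm f p volume).toReal with hA
  have hmeas : AEStronglyMeasurable (fun σ : ℝ => heatD3 (τ + σ) u v w f x)
      (volume.restrict (Ioi (0 : ℝ))) :=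
    (continuousOn_heatD3_const_add hf hp hτ u v w x).aestronglyMeasurable measurableSet_Ioi
  have hdom : Integrable (fun σ : ℝ => A * (τ + σ) ^ (-e)) (volume.restrict (Ioi (0 : ℝ))) :=
    integrableOn_const_mul_rpow_const_add hτ he1 A
  refine hdom.mono' hmeas ?_
  filter_upwards [ae_restrict_mem measurableSet_Ioi] with σ hσ
  have hs : 0 < τ + σ := by have : (0 : ℝ) < σ := hσ; linarith
  have h := hC f hf (τ + σ) hs u v w hu hv hw x
  have hfin : (C : ℝ≥0∞) * ENNReal.ofReal ((τ + σ) ^ (-e)) * eLpNorm f p volume ≠ ⊤ :=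
    (ENNReal.mul_lt_top (ENNReal.mul_lt_top ENNReal.coe_lt_top ENNReal.ofReal_lt_top) hf.2).ne
  have h' := (ENNReal.toReal_le_toReal enorm_ne_top hfin).2 h
  rw [toReal_enorm] at h'
  refine h'.trans (le_of_eq ?_)
  rw [ENNReal.toReal_mul, ENNReal.toReal_mul, ENNReal.coe_toReal,
    ENNReal.toReal_ofReal (Real.rpow_nonneg hs.le _), hA]
  ring

/-- **Additivity of the Leray correction** `f ↦ ∫₀^∞ ∂ᵢ∂ⱼ∂ₖ e^{(τ+σ)Δ} f (x) dσ` on `Lᵖ`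
(both integrands are integrable). [folklore] -/
theorem integral_Ioi_heatD3_add_of_memLp (hp : 1 ≤ p) (hf : MemLp f p volume) (hg : MemLp g p volume)
    {τ : ℝ} (hτ : 0 < τ) (i j k : Fin (Module.finrank ℝ E)) (x : E) :
    ∫ σ in Ioi (0 : ℝ), heatD3 (τ + σ) (stdOrthonormalBasis ℝ E i) (stdOrthonormalBasis ℝ E j)
        (stdOrthonormalBasis ℝ E k) (f + g) x =
      (∫ σ in Ioi (0 : ℝ), heatD3 (τ + σ) (stdOrthonormalBasis ℝ E i) (stdOrthonormalBasis ℝ E j)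
        (stdOrthonormalBasis ℝ E k) f x) +
      ∫ σ in Ioi (0 : ℝ), heatD3 (τ + σ) (stdOrthonormalBasis ℝ E i) (stdOrthonormalBasis ℝ E j)
        (stdOrthonormalBasis ℝ E k) g x := by
  have h1 := integrable_heatD3_const_add_of_memLp hE hp hf hτ (norm_stdOrthonormalBasis_le_one i)
    (norm_stdOrthonormalBasis_le_one j) (norm_stdOrthonormalBasis_le_one k) x
  have h2 := integrable_heatD3_const_add_of_memLp hE hp hg hτ (norm_stdOrthonormalBasis_le_one i)
    (norm_stdOrthonormalBasis_le_one j) (norm_stdOrthonormalBasis_le_one k) x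
  rw [← integral_add h1 h2]
  refine setIntegral_congr_fun measurableSet_Ioi fun σ hσ => ?_
  have hs : 0 < τ + σ := by have : (0 : ℝ) < σ := hσ; linarith
  rw [heatD3_add_of_memLp hf hg hp hs]
  rfl

omit hE in
/-- **Homogeneity of the Leray correction** on `Lᵖ`. [folklore] -/
theorem integral_Ioi_heatD3_smul_of_memLp (hp : 1 ≤ p) (hf : MemLp f p volume) {τ : ℝ} (hτ : 0 < τ)
    (i j k : Fin (Module.finrank ℝ E)) (x : E) (c : ℝ) :
    ∫ σ in Ioi (0 : ℝ), heatD3 (τ + σ) (stdOrthonormalBasis ℝ E i) (stdOrthonormalBasis ℝ E j)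
        (stdOrthonormalBasis ℝ E k) (c • f) x =
      c * ∫ σ in Ioi (0 : ℝ), heatD3 (τ + σ) (stdOrthonormalBasis ℝ E i) (stdOrthonormalBasis ℝ E j)
        (stdOrthonormalBasis ℝ E k) f x := by
  rw [← integral_const_mul]
  refine setIntegral_congr_fun measurableSet_Ioi fun σ hσ => ?_
  have hs : 0 < τ + σ := by have : (0 : ℝ) < σ := hσ; linarith
  simp only [heatD3_smul_of_memLp hf hp hs, Pi.smul_apply, smul_eq_mul]

end D3

/-! ### The Oseen–heat operator is linear on `Lᵖ` matrix fields -/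

section Oseen

variable (hE : Module.finrank ℝ E = 3)
include hE

variable {p : ℝ≥0∞} {F G : Fin (Module.finrank ℝ E) → Fin (Module.finrank ℝ E) → E → ℝ}

/-- **Additivity of the Oseen–heat operator** on `Lᵖ` matrix fields (dimension three):
`(𝒩_τ (F + G))ᵢ (x) = (𝒩_τ F)ᵢ (x) + (𝒩_τ G)ᵢ (x)` at every point, `1 ≤ p ≤ ∞`, `τ > 0`.
[cite: LemarieRieusset2016, §6.2 (the Oseen tensor is a convolution operator)] -/
theorem oseenHeat_add_of_memLp (hp : 1 ≤ p) (hF : ∀ j k, MemLp (F j k) p volume)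
    (hG : ∀ j k, MemLp (G j k) p volume) {τ : ℝ} (hτ : 0 < τ) (i : Fin (Module.finrank ℝ E))
    (x : E) :
    oseenHeat τ (fun j k => F j k + G j k) i x = oseenHeat τ F i x + oseenHeat τ G i x := by
  unfold oseenHeat
  have h1 : ∀ j, heatD1 τ (stdOrthonormalBasis ℝ E j) (F j i + G j i) x =
      heatD1 τ (stdOrthonormalBasis ℝ E j) (F j i) x + heatD1 τ (stdOrthonormalBasis ℝ E j) (G j i) x :=
    fun j => by rw [heatD1_add_of_memLp (hF j i) (hG j i) hp hτ]; rfl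
  have h3 : ∀ j k, ∫ σ in Ioi (0 : ℝ), heatD3 (τ + σ) (stdOrthonormalBasis ℝ E i)
      (stdOrthonormalBasis ℝ E j) (stdOrthonormalBasis ℝ E k) (F j k + G j k) x =
      (∫ σ in Ioi (0 : ℝ), heatD3 (τ + σ) (stdOrthonormalBasis ℝ E i)
        (stdOrthonormalBasis ℝ E j) (stdOrthonormalBasis ℝ E k) (F j k) x) +
      ∫ σ in Ioi (0 : ℝ), heatD3 (τ + σ) (stdOrthonormalBasis ℝ E i)
        (stdOrthonormalBasis ℝ E j) (stdOrthonormalBasis ℝ E k) (G j k) x :=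
    fun j k => integral_Ioi_heatD3_add_of_memLp hE hp (hF j k) (hG j k) hτ i j k x
  simp only [h1, h3, Finset.sum_add_distrib]
  ring

omit hE in
/-- **Homogeneity of the Oseen–heat operator** on `Lᵖ` matrix fields:
`(𝒩_τ (c F))ᵢ (x) = c (𝒩_τ F)ᵢ (x)`. [cite: LemarieRieusset2016, §6.2 (the Oseen tensor is a convolution operator)] -/
theorem oseenHeat_smul_of_memLp (hp : 1 ≤ p) (hF : ∀ j k, MemLp (F j k) p volume) {τ : ℝ}
    (hτ : 0 < τ) (i : Fin (Module.finrank ℝ E)) (x : E) (c : ℝ) :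
    oseenHeat τ (fun j k => c • F j k) i x = c * oseenHeat τ F i x := by
  unfold oseenHeat
  have h1 : ∀ j, heatD1 τ (stdOrthonormalBasis ℝ E j) (c • F j i) x =
      c * heatD1 τ (stdOrthonormalBasis ℝ E j) (F j i) x :=
    fun j => by rw [heatD1_smul_of_memLp (hF j i) hp hτ]; rfl
  have h3 : ∀ j k, ∫ σ in Ioi (0 : ℝ), heatD3 (τ + σ) (stdOrthonormalBasis ℝ E i)
      (stdOrthonormalBasis ℝ E j) (stdOrthonormalBasis ℝ E k) (c • F j k) x =
      c * ∫ σ in Ioi (0 : ℝ), heatD3 (τ + σ) (stdOrthonormalBasis ℝ E i)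
        (stdOrthonormalBasis ℝ E j) (stdOrthonormalBasis ℝ E k) (F j k) x :=
    fun j k => integral_Ioi_heatD3_smul_of_memLp hp (hF j k) hτ i j k x c
  simp only [h1, h3, ← Finset.mul_sum]
  ring

omit hE in
/-- `(𝒩_τ (-F))ᵢ = -(𝒩_τ F)ᵢ` on `Lᵖ` matrix fields. [cite: LemarieRieusset2016, §6.2 (the Oseen tensor is a convolution operator)] -/
theorem oseenHeat_neg_of_memLp (hp : 1 ≤ p) (hF : ∀ j k, MemLp (F j k) p volume) {τ : ℝ}
    (hτ : 0 < τ) (i : Fin (Module.finrank ℝ E)) (x : E) :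
    oseenHeat τ (fun j k => -F j k) i x = -oseenHeat τ F i x := by
  have h := oseenHeat_smul_of_memLp hp hF hτ i x (-1)
  simp only [neg_one_smul, neg_one_mul] at h
  exact h

/-- **The Oseen–heat operator of a difference** on `Lᵖ` matrix fields (dimension three):
`(𝒩_τ (F - G))ᵢ = (𝒩_τ F)ᵢ - (𝒩_τ G)ᵢ` — the identity behind
`B(u,u) - B(v,v) = B(u - v, u) + B(v, u - v)` (Lemarié-Rieusset 2016, (7.54)). [cite: LemarieRieusset2016, (7.54)] -/
theorem oseenHeat_sub_of_memLp (hp : 1 ≤ p) (hF : ∀ j k, MemLp (F j k) p volume)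
    (hG : ∀ j k, MemLp (G j k) p volume) {τ : ℝ} (hτ : 0 < τ) (i : Fin (Module.finrank ℝ E))
    (x : E) :
    oseenHeat τ (fun j k => F j k - G j k) i x = oseenHeat τ F i x - oseenHeat τ G i x := by
  have hG' : ∀ j k, MemLp (fun y => -G j k y) p volume := fun j k => (hG j k).neg
  have h1 := oseenHeat_add_of_memLp hE hp hF (G := fun j k => -G j k) hG' hτ i x
  have h2 := oseenHeat_neg_of_memLp hp hG hτ i x
  have heq : (fun j k => F j k - G j k) = fun j k => F j k + -G j k := by
    funext j k
    exact sub_eq_add_neg _ _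
  rw [heq, h1]
  have h2' : oseenHeat τ (fun j k => -G j k) i x = -oseenHeat τ G i x := h2
  rw [h2', ← sub_eq_add_neg]

end Oseen

end Literature.Analysis.FluidPDE
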